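import Mathlib
import Summits.Ventures.PercRepro.PuncturedLYMMixT2Q3Table1
import Summits.Ventures.PercRepro.PuncturedLYMMixT2Q3Table2

/-!
# PercRepro — (SP) FOR `2` PAIRWISE DISJOINT TRIPLES AND `3` PAIRWISE DISJOINT QUADRUPLES AT LEVEL `4`: POSITIVITY OF THE DENOMINATORS (1)
(p10, gen 41)

`den > 0`, `Pc > 0` for `n ≥ 18`; `Yc > 0` for `n ≥ 5`.  Nothing here asserts (SP).
-/

namespace PercRepro.PuncturedLYM.Split.TypeLift.MixT2Q3

/-- `den > 0` for `n ≥ 18`. -/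
theorem den_pos (n : ℚ) (hn : 18 ≤ n) : 0 < den n := by
  obtain ⟨n', hn', rfl⟩ : ∃ n', 0 ≤ n' ∧ n = 18 + n' := ⟨n - 18, by linarith, by ring⟩
  have h : den (18 + n') = 373248 * n' ^ 18 + 109610496 * n' ^ 17 + 15194679840 * n' ^ 16 + 1321111621296 * n' ^ 15 + 80730782389368 * n' ^ 14 + 3681926560410228 * n' ^ 13 + 129880842705293616 * n' ^ 12 + 3623235140295347868 * n' ^ 11 + 81030435966892151400 * n' ^ 10 + 1463611358028142249692 * n' ^ 9 + 21401782558037011064352 * n' ^ 8 + 252744029133421635185460 * n' ^ 7 + 2392620311167646170911024 * n' ^ 6 + 17909797021589239935185328 * n' ^ 5 + 103672839589998131949314688 * n' ^ 4 + 447795767696341434756941952 * n' ^ 3 + 1359039131649719891349599232 * n' ^ 2 + 2586180172502815250531862528 * n' + 2322296596897378781287956480 := by unfold den; ring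
  rw [h]; positivity

/-- `Yc > 0` for `n ≥ 5`. -/
theorem Yc_pos (n : ℚ) (hn : 5 ≤ n) : 0 < Yc n := by
  obtain ⟨n', hn', rfl⟩ : ∃ n', 0 ≤ n' ∧ n = 5 + n' := ⟨n - 5, by linarith, by ring⟩
  have h : Yc (5 + n') = (1 / 120) * n' ^ 5 + (1 / 8) * n' ^ 4 + (17 / 24) * n' ^ 3 + (15 / 8) * n' ^ 2 + (137 / 60) * n' + 1 := by unfold Yc; ring
  rw [h]; positivity

/-- `Pc > 0` for `n ≥ 18`. -/
theorem Pc_pos (n : ℚ) (hn : 18 ≤ n) : 0 < Pc n := by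
  obtain ⟨n', hn', rfl⟩ : ∃ n', 0 ≤ n' ∧ n = 18 + n' := ⟨n - 18, by linarith, by ring⟩
  have h : Pc (18 + n') = (1 / 24) * n' ^ 4 + (11 / 4) * n' ^ 3 + (1631 / 24) * n' ^ 2 + (2973 / 4) * n' + 3027 := by unfold Pc; ring
  rw [h]; positivity

end PercRepro.PuncturedLYM.Split.TypeLift.MixT2Q3
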